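import Summits.Langlands.Langlands.Theorems.PhantomRMYoshidaResiduallyYoshidaLiftingResidualSplitting
import HarnessLib

/-!
# Route `PhantomRMYoshida`, crux `ResiduallyYoshidaLifting` (stmt-Langlands-13639), line
# `sector-klingen-split`: stub `stub_residualBlockDiagonalFrame` — a `ℤ̄_p`-integral frame with
# block-diagonal reduction over the residue field `κ`, with `f`, `a`, `d` exposed

Lead prover-line-stmt-Langlands-13639-c2-0 (2026-08-17), registered stub `stub_residualBlockDiagonalFrame`
(`--supports stmt-Langlands-13639`), namespace
`Summit.Langlands.Langlands.Cruxes.ResiduallyYoshidaLifting.SectorKlingenSplit`.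

This is the SAME construction as p86009 `stub_residualYoshidaSplitting`
(`PhantomRMYoshidaResiduallyYoshidaLiftingResidualSplitting.lean`, namespace `…EndoscopicCrossingEuler`)
minus its last step (the Brauer–Nesbitt conjugation `stub_blockSumConj` of the diagonal blocks to
`σ̄ ⊕ σ̄'` over `k`): the residual frame is kept over `κ = ℤ̄_p/𝔪` and the intermediate data are exposed.
For `r : Γ_ℚ → GL₄(ℚ̄_p)` (`ℚ̄_p = PadicAlgCl p`, `ℤ̄_p = Valued.integer (PadicAlgCl p)`) whose Frobenius
polynomials reduce through `red : ℤ̄_p → k` (`char k = p`) to `charpoly σ · charpoly σ'` (`σ, σ'`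
irreducible) we produce

* a frame `P ∈ GL₄(ℚ̄_p)` and an integral model `rint = P⁻¹ r P : Γ_ℚ → GL₄(ℤ̄_p)`
  (`exists_integralModel_of_valuationSubring` over the non-noetherian valuation ring `ℤ̄_p`, then the
  `ϖ`-trick `stub_splitFrame`);
* the factorisation `red = f ∘ (mod 𝔪)` (`exists_residueField_factor`; `κ` is algebraically closed,
  `isAlgClosed_residueField`);
* homomorphisms `a, d : Γ_ℚ → GL₂(κ)` with `rint g mod 𝔪 = (a g, 0; 0, d g)` BLOCK DIAGONAL
  (`stub_residualCharpoly` + `stub_residualTriangular` + `stub_splitFrame`), `a ⊗_f k`, `d ⊗_f k`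
  irreducible, and the product identity
  `charpoly (f (a g)) · charpoly (f (d g)) = charpoly (σ g) · charpoly (σ' g)` for every `g`.

Consumer: Ribet's non-split lattice over `ℤ̄_p` (stub `stub_ribetNonsplitLattice` of the same line) and the
Brauer–Nesbitt orientation of the blocks (`stub_blockOrientation`).

References: J.-P. Serre, *Abelian ℓ-adic representations and elliptic curves* (1968), Ch. I §1.1
[SerreAbelianLadic1968]; J. Bellaïche, G. Chenevier, *Families of Galois representations and Selmer
groups*, Astérisque 324 (2009), §1.5 [BellaicheChenevier2009]; K. Ribet, Invent. Math. 34 (1976),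
Prop. 2.1 [Ribet1976].
-/

noncomputable section

-- `Summit.Langlands.Langlands.…` (summit = sub-problem name, D-0017 layout) trips `dupNamespace` on every decl.
set_option linter.dupNamespace false
set_option autoImplicit false

open IsDedekindDomain Filter
open Literature.NumberTheory.GaloisRepresentations Literature.NumberTheory.Automorphic
open Summit.Langlands.Langlands.Cruxes.ResiduallyYoshidaLifting.EndoscopicCrossingEuler

namespace Summit.Langlands.Langlands.Cruxes.ResiduallyYoshidaLifting.SectorKlingenSplit

/-- **Stub `stub_residualBlockDiagonalFrame` (registered, statement verbatim): a `ℤ̄_p`-integral frame of a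
residually-Yoshida `r : Γ_ℚ → GL₄(ℚ̄_p)` with BLOCK-DIAGONAL reduction over the residue field `κ = ℤ̄_p/𝔪`.**
If the Frobenius polynomials of `r` reduce through `red : ℤ̄_p → k` to `charpoly σ · charpoly σ'` (`σ, σ'`
irreducible, a.e. `v`), there are `P ∈ GL₄(ℚ̄_p)`, an integral model `rint = P⁻¹ r P : Γ_ℚ → GL₄(ℤ̄_p)`, the
factorisation `red = f ∘ (mod 𝔪)`, and homomorphisms `a, d : Γ_ℚ → GL₂(κ)` with `rint mod 𝔪 = (a, 0; 0, d)`,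
`a ⊗_f k` and `d ⊗_f k` irreducible, and `charpoly (f a(g)) · charpoly (f d(g)) = charpoly σ(g) · charpoly σ'(g)`.
Proof (p86009 minus its last step): integral model over the valuation ring `ℤ̄_p`
(`exists_integralModel_of_valuationSubring`); `red = f ∘ residue` with `κ` algebraically closed; Chebotarev gives
the characteristic polynomials of the reduction at every `g` (`stub_residualCharpoly`); Brauer–Nesbitt, Burnside
and dévissage give a residual basis making it block upper triangular with irreducible diagonal blocks
(`stub_residualTriangular`); the `ϖ`-trick gives a new frame with block diagonal reduction (`stub_splitFrame`);
the product identity is `charpoly` of a block-triangular matrix, invariant under conjugation.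
[cite: BellaicheChenevier2009, §1.5; Ribet1976, Prop. 2.1; SerreAbelianLadic1968, I §1.1] -/
theorem stub_residualBlockDiagonalFrame :
    ∀ (p : ℕ) [Fact p.Prime] (k : Type) [Field k] [CharP k p] [IsAlgClosed k]
      [TopologicalSpace k] [DiscreteTopology k] (red : Valued.integer (PadicAlgCl p) →+* k)
      (σ σ' : FramedGaloisRep ℚ k 2) (r : FramedGaloisRep ℚ (PadicAlgCl p) 4),
      σ.toGaloisRep.IsIrreducible → σ'.toGaloisRep.IsIrreducible →
      (∀ᶠ v : HeightOneSpectrum (NumberField.RingOfIntegers ℚ) in Filter.cofinite,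
        r.IsUnramifiedAt v ∧ σ.IsUnramifiedAt v ∧ σ'.IsUnramifiedAt v ∧
        ∃ (P : Polynomial (Valued.integer (PadicAlgCl p))) (P₁ P₂ : Polynomial k),
          r.HasFrobCharpolyAt v (P.map (Valued.integer (PadicAlgCl p)).subtype) ∧
          σ.HasFrobCharpolyAt v P₁ ∧ σ'.HasFrobCharpolyAt v P₂ ∧ P.map red = P₁ * P₂) →
      ∃ (P : GL (Fin 4) (PadicAlgCl p))
        (rint : Field.absoluteGaloisGroup ℚ →* GL (Fin 4) (Valued.integer (PadicAlgCl p)))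
        (f : IsLocalRing.ResidueField (Valued.integer (PadicAlgCl p)) →+* k)
        (a d : Field.absoluteGaloisGroup ℚ →* GL (Fin 2) (IsLocalRing.ResidueField (Valued.integer (PadicAlgCl p)))),
        (∀ x, f (IsLocalRing.residue (Valued.integer (PadicAlgCl p)) x) = red x) ∧
        (∀ g, Matrix.GeneralLinearGroup.map (Valued.integer (PadicAlgCl p)).subtype (rint g) = P⁻¹ * r g * P) ∧
        (∀ g, (Matrix.GeneralLinearGroup.map (IsLocalRing.residue (Valued.integer (PadicAlgCl p))) (rint g)).val =
          Matrix.reindex finSumFinEquiv finSumFinEquiv (Matrix.fromBlocks (a g).val 0 0 (d g).val)) ∧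
        Representation.IsIrreducible ((Representation.ofDistribMulAction k (GL (Fin 2) k) (Fin 2 → k)).comp
          ((Matrix.GeneralLinearGroup.map f).comp a)) ∧
        Representation.IsIrreducible ((Representation.ofDistribMulAction k (GL (Fin 2) k) (Fin 2 → k)).comp
          ((Matrix.GeneralLinearGroup.map f).comp d)) ∧
        (∀ g, (Matrix.GeneralLinearGroup.map f (a g)).val.charpoly * (Matrix.GeneralLinearGroup.map f (d g)).val.charpoly =
          (σ g).val.charpoly * (σ' g).val.charpoly) := by
  intro p _ k _ _ _ _ _ red σ σ' r hσirr hσ'irr hae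
  classical
  -- an integral model over the valuation ring `ℤ̄_p` (non-noetherian: Serre's remark, Bézout form)
  obtain ⟨P, rint₀, hP⟩ : ∃ (P : GL (Fin 4) (PadicAlgCl p))
      (rint₀ : Field.absoluteGaloisGroup ℚ →* GL (Fin 4) (Valued.integer (PadicAlgCl p))),
      ∀ g, Matrix.GeneralLinearGroup.map (Valued.integer (PadicAlgCl p)).subtype (rint₀ g) =
        P⁻¹ * r g * P :=
    exists_integralModel_of_valuationSubring (Valued.isOpen_valuationSubring (PadicAlgCl p)) r
  -- `red = f ∘ residue`; the residue field `κ` is algebraically closed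
  obtain ⟨f, hf⟩ := exists_residueField_factor red
  haveI : IsAlgClosed (IsLocalRing.ResidueField (Valued.integer (PadicAlgCl p))) :=
    isAlgClosed_residueField
  have hfres : f.comp (IsLocalRing.residue (Valued.integer (PadicAlgCl p))) = red :=
    RingHom.ext hf
  -- characteristic polynomials of the reduction, for every `g` (Chebotarev)
  have hchar := stub_residualCharpoly p k red σ σ' r P rint₀ hP hae
  -- the reduction `ρ̄ : Γ_ℚ → GL₄(κ)`
  set ρbar : Field.absoluteGaloisGroup ℚ →*
      GL (Fin 4) (IsLocalRing.ResidueField (Valued.integer (PadicAlgCl p))) :=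
    (Matrix.GeneralLinearGroup.map (IsLocalRing.residue (Valued.integer (PadicAlgCl p)))).comp rint₀
    with hρbar
  have hρbar_val : ∀ g, (ρbar g).val =
      (rint₀ g).val.map (IsLocalRing.residue (Valued.integer (PadicAlgCl p))) := fun g => rfl
  have hcharbar : ∀ g, ((ρbar g).val.charpoly).map f = (σ g).val.charpoly * (σ' g).val.charpoly := by
    intro g
    rw [hρbar_val, Matrix.charpoly_map, Polynomial.map_map, hfres]
    exact hchar g
  -- block upper triangular form over `κ`, irreducible diagonal blocks over `k`
  obtain ⟨w, a, d, b, hw, hairr, hdirr⟩ :=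
    stub_residualTriangular (IsLocalRing.ResidueField (Valued.integer (PadicAlgCl p))) k f
      (Field.absoluteGaloisGroup ℚ) ρbar σ.toMonoidHom σ'.toMonoidHom hσirr hσ'irr hcharbar
  -- the `ϖ`-trick: a new frame with block DIAGONAL reduction
  obtain ⟨P', rint', hP', hred'⟩ :=
    stub_splitFrame p r P rint₀ w (fun g => (a g).val) (fun g => b g) (fun g => (d g).val) hP hw
  -- the product identity of characteristic polynomials (charpoly of a block-triangular conjugate)
  have hmapval : ∀ (u : GL (Fin 2) (IsLocalRing.ResidueField (Valued.integer (PadicAlgCl p)))),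
      (Matrix.GeneralLinearGroup.map f u).val = u.val.map f := fun u => rfl
  refine ⟨P', rint', f, a, d, hf, hP', hred', hairr, hdirr, fun g => ?_⟩
  rw [hmapval, hmapval, Matrix.charpoly_map, Matrix.charpoly_map, ← Polynomial.map_mul, ← hcharbar g]
  congr 1
  have h1 : ((w⁻¹ * ρbar g * w).val).charpoly = (ρbar g).val.charpoly := by
    rw [Units.val_mul, Units.val_mul, Matrix.coe_units_inv]
    exact Matrix.charpoly_units_conj' w _
  rw [← h1, hw g, Matrix.charpoly_reindex, Matrix.charpoly_fromBlocks_zero₂₁]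

end Summit.Langlands.Langlands.Cruxes.ResiduallyYoshidaLifting.SectorKlingenSplit
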